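import Literature.NumberTheory.Sieve.BombieriAsymptoticSieveGeneralHyp
import HarnessLib

/-!
# Bombieri's asymptotic sieve under the hypotheses of `Literature.NumberTheory.Sieve.bombieri_asymptotic_sieve`: Lemma 11

Topic `Literature/NumberTheory/Sieve`, companion file of `BombieriAsymptoticSieve.lean`,
`BombieriAsymptoticSieveLemma11.lean` and `ParityBarrier.lean`. Everything here is PROVED
(theorems only, no new definitions, no `sorry`).

[FriedlanderIwaniecPisa1978] Lemma 11 bounds
`Σ₂ = ∑_{n ≤ x, (n,P(z))=1} a_n ∑_{d ∣ n, d ≥ y} μ(d)(log n/d)^k` by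
`≪ A(x)(log x/y)^{k+1}(log z)^{−2}`. `BombieriAsymptoticSieveLemma11.lean` proves it under Bombieri's
axioms (A₁)–(A₅) (`FI1978_lemma11_holds`); here it is proved under the hypotheses of the tree's
`Literature.NumberTheory.Sieve.bombieri_asymptotic_sieve` (`ParityBarrier.lean`): size `X(x) = x`, `HasSieveDimension g 1 K`,
`HasDensityConstant H`, level of distribution `x^θ` for every `θ < 1` on SQUAREFREE moduli only, and
`∑_{n≤x} a_n² ≪ x(log x)^C` (`treeLemma11`, in the shape consumed by the assembly of the theorem).
The only new point is that the subsequences `𝒜_m` with `m` rough but not squarefree cannot be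
sieved (their moduli `νm` are not squarefree); they are shown to be negligible by Cauchy–Schwarz:
a rough non-squarefree `n ≤ x` is divisible by `p²` with `p ≥ z ≥ x^ν`, there are `≤ 2x/z` of them
(`card_rough_not_squarefree_le`), and each has `τ(n) ≤ 2^{Ω(n)} ≤ 2^{1/ν}` divisors
(`card_divisors_le_of_rough`).

## References

* J. Friedlander, H. Iwaniec, *On Bombieri's asymptotic sieve*, Ann. Scuola Norm. Sup. Pisa
  Cl. Sci. (4) 5 (1978), 719–756, Lemma 11. [FriedlanderIwaniecPisa1978]
* E. Bombieri, *The asymptotic sieve*, Rend. Accad. Naz. XL (5) 1/2 (1975/76), 243–269.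
  [BombieriAsymptoticSieve1976]
-/

open Filter Finset Asymptotics
open scoped Topology ArithmeticFunction.Moebius ArithmeticFunction.Omega ArithmeticFunction.sigma

noncomputable section

namespace Literature.NumberTheory.Sieve

namespace BombieriSieve

/-- `τ(n) ≤ 2^{Ω(n)}` (`e + 1 ≤ 2^e` at each prime power). [folklore] -/
theorem card_divisors_le_two_pow_cardFactors {n : ℕ} (hn : n ≠ 0) :
    n.divisors.card ≤ 2 ^ Ω n := by
  rw [Nat.card_divisors hn, ArithmeticFunction.cardFactors_apply,
    ← List.sum_toFinset_count_eq_length, ← Finset.prod_pow_eq_pow_sum]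
  have hset : n.primeFactorsList.toFinset = n.primeFactors := rfl
  rw [hset]
  refine Finset.prod_le_prod' fun p hp => ?_
  rw [Nat.primeFactorsList_count_eq]
  exact Nat.succ_le_of_lt Nat.lt_two_pow_self

/-- If every prime factor of `n ≠ 0` is `≥ m`, then `m^{Ω(n)} ≤ n`. [folklore] -/
theorem pow_cardFactors_le {n m : ℕ} (hn : n ≠ 0) (h : ∀ p ∈ n.primeFactors, m ≤ p) :
    m ^ Ω n ≤ n := by
  rw [ArithmeticFunction.cardFactors_apply]
  calc m ^ n.primeFactorsList.length ≤ n.primeFactorsList.prod :=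
        List.pow_card_le_prod n.primeFactorsList m fun p hp =>
          h p (Nat.mem_primeFactors_iff_mem_primeFactorsList.mpr hp)
    _ = n := Nat.prod_primeFactorsList hn

/-- `∑_{a ≤ n ≤ b} 1/n² ≤ 1/(a − 1)` for `a ≥ 2`. [folklore] -/
theorem sum_Icc_inv_sq_le {a : ℕ} (ha : 2 ≤ a) (b : ℕ) :
    ∑ n ∈ Icc a b, ((n : ℝ) ^ 2)⁻¹ ≤ 1 / ((a : ℝ) - 1) := by
  have key : ∀ b : ℕ, ∑ n ∈ Icc a b, ((n : ℝ) ^ 2)⁻¹ ≤ 1 / ((a : ℝ) - 1) - 1 / (max a b : ℕ) := by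
    intro b
    induction b with
    | zero =>
      have : Icc a 0 = ∅ := Finset.Icc_eq_empty (by omega)
      rw [this, Finset.sum_empty, Nat.max_eq_left (Nat.zero_le a)]
      have ha' : (2 : ℝ) ≤ a := by exact_mod_cast ha
      rw [sub_nonneg, one_div_le_one_div (by linarith) (by linarith)]
      linarith
    | succ b ih =>
      by_cases hab : a ≤ b + 1
      · rw [Finset.sum_Icc_succ_top hab, Nat.max_eq_right hab]
        have ha' : (2 : ℝ) ≤ a := by exact_mod_cast ha
        rcases eq_or_lt_of_le hab with h | h
        · -- `a = b + 1`: single term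
          subst h
          have : Icc (b + 1) b = ∅ := Finset.Icc_eq_empty (by omega)
          rw [this, Finset.sum_empty, zero_add]
          push_cast
          have hb1 : (1 : ℝ) ≤ b := by
            have : (2 : ℝ) ≤ (b : ℝ) + 1 := by exact_mod_cast ha
            linarith
          rw [show ((b : ℝ) + 1 - 1) = b by ring]
          rw [inv_eq_one_div, le_sub_iff_add_le, div_add_div _ _ (by positivity) (by positivity),
            div_le_div_iff₀ (by positivity) (by positivity)]
          nlinarith
        · have hmax : max a b = b := Nat.max_eq_right (by omega)
          rw [hmax] at ih
          have hb1 : (1 : ℝ) ≤ b := by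
            have : a ≤ b := by omega
            have : (2 : ℝ) ≤ b := by exact_mod_cast (ha.trans this)
            linarith
          have hstep : ((((b + 1 : ℕ) : ℝ)) ^ 2)⁻¹ ≤ 1 / (b : ℝ) - 1 / ((b + 1 : ℕ) : ℝ) := by
            push_cast
            rw [inv_eq_one_div, div_sub_div _ _ (by positivity) (by positivity),
              div_le_div_iff₀ (by positivity) (by positivity)]
            nlinarith
          linarith
      · push Not at hab
        have : Icc a (b + 1) = ∅ := Finset.Icc_eq_empty (by omega)
        rw [this, Finset.sum_empty, Nat.max_eq_left hab.le]
        have ha' : (2 : ℝ) ≤ a := by exact_mod_cast ha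
        rw [sub_nonneg, one_div_le_one_div (by linarith) (by linarith)]
        linarith
  refine (key b).trans (sub_le_self _ ?_)
  positivity


/-! ### The non-squarefree rough numbers are negligible -/

/-- The number of `z`-rough non-squarefree `n ≤ x` is at most `2x/z` (`z ≥ 2`): such an `n` is
divisible by `p²` for a prime `p ≥ z`. [folklore] -/
theorem card_rough_not_squarefree_le {x z : ℝ} (hz : 2 ≤ z) (hx : 0 ≤ x) :
    ((((Ioc 0 ⌊x⌋₊).filter
        (fun n : ℕ => n.Coprime (primesProdBelow z) ∧ ¬ Squarefree n)).card : ℕ) : ℝ) ≤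
      2 * x / z := by
  set T := (Ioc 0 ⌊x⌋₊).filter (fun n : ℕ => n.Coprime (primesProdBelow z) ∧ ¬ Squarefree n)
    with hT
  set PP := Icc ⌈z⌉₊ ⌊x⌋₊ with hPP
  have hz2 : 2 ≤ ⌈z⌉₊ := by
    have : (2 : ℝ) ≤ ⌈z⌉₊ := hz.trans (Nat.le_ceil z); exact_mod_cast this
  have hsub : T ⊆ PP.biUnion (fun p => (Ioc 0 ⌊x⌋₊).filter (fun n : ℕ => p * p ∣ n)) := by
    intro n hn
    rw [hT, Finset.mem_filter] at hn
    obtain ⟨hn, hcop, hnsf⟩ := hn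
    have hn0 : n ≠ 0 := (Finset.mem_Ioc.mp hn).1.ne'
    rw [Nat.squarefree_iff_prime_squarefree] at hnsf
    push Not at hnsf
    obtain ⟨p, hp, hpn⟩ := hnsf
    have hpn' : p ∣ n := (dvd_mul_right p p).trans hpn
    have hzp : z ≤ (p : ℝ) := by
      by_contra hlt
      push Not at hlt
      exact hp.coprime_iff_not_dvd.mp (Nat.Coprime.coprime_dvd_left hpn' hcop)
        ((dvd_primesProdBelow_iff hp z).mpr hlt)
    rw [Finset.mem_biUnion]
    refine ⟨p, ?_, Finset.mem_filter.mpr ⟨hn, hpn⟩⟩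
    rw [hPP, Finset.mem_Icc]
    refine ⟨Nat.ceil_le.mpr hzp, ?_⟩
    have h1 : p * p ≤ n := Nat.le_of_dvd (Nat.pos_of_ne_zero hn0) hpn
    have h2 : n ≤ ⌊x⌋₊ := (Finset.mem_Ioc.mp hn).2
    nlinarith [hp.one_lt.le]
  have hcard := (Finset.card_le_card hsub).trans Finset.card_biUnion_le
  have hcast : ((T.card : ℕ) : ℝ) ≤
      ∑ p ∈ PP, ((((Ioc 0 ⌊x⌋₊).filter (fun n : ℕ => p * p ∣ n)).card : ℕ) : ℝ) := by
    exact_mod_cast hcard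
  refine hcast.trans ?_
  have hterm : ∀ p ∈ PP, ((((Ioc 0 ⌊x⌋₊).filter (fun n : ℕ => p * p ∣ n)).card : ℕ) : ℝ) ≤
      x * (((p : ℝ) ^ 2)⁻¹) := by
    intro p hp
    have hp1 : 1 ≤ p := le_trans (by omega) (Finset.mem_Icc.mp hp).1
    rw [Nat.Ioc_filter_dvd_card_eq_div]
    calc (((⌊x⌋₊ / (p * p) : ℕ)) : ℝ) ≤ (⌊x⌋₊ : ℝ) / ((p * p : ℕ) : ℝ) := Nat.cast_div_le
      _ ≤ x / ((p * p : ℕ) : ℝ) := div_le_div_of_nonneg_right (Nat.floor_le hx) (by positivity)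
      _ = x * ((p : ℝ) ^ 2)⁻¹ := by push_cast; rw [div_eq_mul_inv, pow_two]
  refine (Finset.sum_le_sum hterm).trans ?_
  rw [← Finset.mul_sum]
  have hs := sum_Icc_inv_sq_le hz2 ⌊x⌋₊
  have hz' : z / 2 ≤ (⌈z⌉₊ : ℝ) - 1 := by linarith [Nat.le_ceil z]
  calc x * ∑ p ∈ PP, ((p : ℝ) ^ 2)⁻¹ ≤ x * (1 / ((⌈z⌉₊ : ℝ) - 1)) :=
        mul_le_mul_of_nonneg_left hs hx
    _ ≤ x * (1 / (z / 2)) := by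
        refine mul_le_mul_of_nonneg_left ?_ hx
        exact one_div_le_one_div_of_le (by linarith) hz'
    _ = 2 * x / z := by field_simp

/-- Divisors of a `z`-rough `n ≤ x` with `z ≥ x^ν`: `τ(n) ≤ 2^{Ω(n)} ≤ 2^{1/ν}`. [folklore] -/
theorem card_divisors_le_of_rough {x z ν : ℝ} (hν : 0 < ν) (hx : 1 < x) (hz : 2 ≤ z)
    (hxz : x ^ ν ≤ z) {n : ℕ} (hn : n ≠ 0) (hnx : (n : ℝ) ≤ x)
    (hcop : n.Coprime (primesProdBelow z)) :
    ((n.divisors.card : ℕ) : ℝ) ≤ (2 : ℝ) ^ (1 / ν) := by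
  have hx0 : 0 < x := by linarith
  have hfac : ∀ p ∈ n.primeFactors, ⌈z⌉₊ ≤ p := by
    intro p hp
    have hpp := Nat.prime_of_mem_primeFactors hp
    have hpn := Nat.dvd_of_mem_primeFactors hp
    refine Nat.ceil_le.mpr ?_
    by_contra hlt
    push Not at hlt
    exact hpp.coprime_iff_not_dvd.mp (Nat.Coprime.coprime_dvd_left hpn hcop)
      ((dvd_primesProdBelow_iff hpp z).mpr hlt)
  have hpow := pow_cardFactors_le hn hfac
  have hz1 : 1 < z := by linarith
  have hzc : z ≤ (⌈z⌉₊ : ℝ) := Nat.le_ceil z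
  have hΩ : (Ω n : ℝ) * Real.log z ≤ Real.log x := by
    have h1 : (z : ℝ) ^ (Ω n) ≤ n := by
      calc z ^ (Ω n) ≤ (⌈z⌉₊ : ℝ) ^ (Ω n) := pow_le_pow_left₀ (by linarith) hzc _
        _ ≤ n := by exact_mod_cast hpow
    have h2 : Real.log (z ^ (Ω n)) ≤ Real.log x :=
      Real.log_le_log (pow_pos (by linarith) _) (h1.trans hnx)
    rwa [Real.log_pow] at h2
  have hlogz : ν * Real.log x ≤ Real.log z := by
    have := Real.log_le_log (Real.rpow_pos_of_pos hx0 ν) hxz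
    rwa [Real.log_rpow hx0] at this
  have hlogx : 0 < Real.log x := Real.log_pos hx
  have hΩν : (Ω n : ℝ) ≤ 1 / ν := by
    rw [le_div_iff₀ hν]
    have : (Ω n : ℝ) * (ν * Real.log x) ≤ Real.log x :=
      (mul_le_mul_of_nonneg_left hlogz (Nat.cast_nonneg _)).trans hΩ
    nlinarith
  calc ((n.divisors.card : ℕ) : ℝ) ≤ ((2 ^ Ω n : ℕ) : ℝ) := by
        exact_mod_cast card_divisors_le_two_pow_cardFactors hn
    _ = (2 : ℝ) ^ ((Ω n : ℕ) : ℝ) := by push_cast; rw [Real.rpow_natCast]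
    _ ≤ (2 : ℝ) ^ (1 / ν) := Real.rpow_le_rpow_of_exponent_le one_le_two hΩν

/-- The sifted sums of the subsequences `𝒜_m` over the rough NON-squarefree `m ≤ x/y` are bounded
by `2^{1/ν}` times the mass of the rough non-squarefree `n ≤ x` (each such `n` has at most
`τ(n) ≤ 2^{1/ν}` divisors). [folklore] -/
theorem sum_sifted_restrictDvd_not_squarefree_le (A : SieveSequence) {x y z ν : ℝ} (hν : 0 < ν)
    (hx : 1 < x) (hz : 2 ≤ z) (hxz : x ^ ν ≤ z) :
    ∑ m ∈ ((Ioc 0 ⌊x / y⌋₊).filter (fun m : ℕ => m.Coprime (primesProdBelow z))).filter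
        (fun m => ¬ Squarefree m), (A.restrictDvd m).sifted x (primesProdBelow z) ≤
      (2 : ℝ) ^ (1 / ν) * ∑ n ∈ (Ioc 0 ⌊x⌋₊).filter
        (fun n : ℕ => n.Coprime (primesProdBelow z) ∧ ¬ Squarefree n), A.a n := by
  have hx0 : 0 < x := by linarith
  set P := primesProdBelow z with hP
  set M' := ((Ioc 0 ⌊x / y⌋₊).filter (fun m : ℕ => m.Coprime P)).filter
    (fun m => ¬ Squarefree m) with hM'
  have hsift : ∀ m : ℕ, (A.restrictDvd m).sifted x P =
      ∑ n ∈ (Ioc 0 ⌊x⌋₊).filter (fun n : ℕ => n.Coprime P),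
        if m ∣ n then A.a n else 0 := fun m => rfl
  simp_rw [hsift]
  rw [Finset.sum_comm]
  have hinner : ∀ n ∈ (Ioc 0 ⌊x⌋₊).filter (fun n : ℕ => n.Coprime P),
      ∑ m ∈ M', (if m ∣ n then A.a n else 0) ≤
        if Squarefree n then 0 else (2 : ℝ) ^ (1 / ν) * A.a n := by
    intro n hn
    obtain ⟨hn, hnP⟩ := Finset.mem_filter.mp hn
    have hn0 : n ≠ 0 := (Finset.mem_Ioc.mp hn).1.ne'
    rw [Finset.sum_ite, Finset.sum_const_zero, add_zero, Finset.sum_const, nsmul_eq_mul]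
    split_ifs with hnsf
    · have hempty : M'.filter (fun m => m ∣ n) = ∅ := by
        refine Finset.filter_false_of_mem fun m hm hmn => ?_
        exact (Finset.mem_filter.mp hm).2 (hnsf.squarefree_of_dvd hmn)
      rw [hempty]; simp
    · refine mul_le_mul_of_nonneg_right ?_ (A.a_nonneg n)
      have hsub : M'.filter (fun m => m ∣ n) ⊆ n.divisors := fun m hm =>
        Nat.mem_divisors.mpr ⟨(Finset.mem_filter.mp hm).2, hn0⟩
      have hnx : (n : ℝ) ≤ x := (Nat.cast_le.mpr (Finset.mem_Ioc.mp hn).2).trans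
        (Nat.floor_le hx0.le)
      calc (((M'.filter (fun m => m ∣ n)).card : ℕ) : ℝ)
          ≤ ((n.divisors.card : ℕ) : ℝ) := by exact_mod_cast Finset.card_le_card hsub
        _ ≤ (2 : ℝ) ^ (1 / ν) := card_divisors_le_of_rough hν hx hz hxz hn0 hnx (hP ▸ hnP)
  refine (Finset.sum_le_sum hinner).trans (le_of_eq ?_)
  rw [Finset.sum_ite, Finset.sum_const_zero, zero_add, ← Finset.mul_sum, Finset.filter_filter]

/-- Cauchy–Schwarz for the rough non-squarefree `n ≤ x` (`z ≥ x^ν`): their mass, times `2^{1/ν}`,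
is at most `x/(2 log x)` once `∑_{n≤x} a_n² ≤ K_c x (log x)^{C_c}` and
`(log x)^{C_c+2} x^{−ν} ≤ (2^{2/ν+3} K_c)⁻¹`. [folklore] -/
theorem mass_rough_not_squarefree_le (A : SieveSequence) {x z ν Kc Cc : ℝ} (hν : 0 < ν)
    (hx : 1 < x) (hz : 2 ≤ z) (hxz : x ^ ν ≤ z) (hKc : 0 < Kc)
    (hcr : ∑ n ∈ Ioc 0 ⌊x⌋₊, A.a n ^ 2 ≤ Kc * x * Real.log x ^ Cc)
    (hsmall : Real.log x ^ (Cc + 2) / x ^ ν ≤ ((2 : ℝ) ^ (2 / ν + 3) * Kc)⁻¹) :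
    (2 : ℝ) ^ (1 / ν) * ∑ n ∈ (Ioc 0 ⌊x⌋₊).filter
        (fun n : ℕ => n.Coprime (primesProdBelow z) ∧ ¬ Squarefree n), A.a n ≤
      x / (2 * Real.log x) := by
  have hx0 : 0 < x := by linarith
  have hz0 : 0 < z := by linarith
  have hlogx0 : 0 < Real.log x := Real.log_pos hx
  have h2ν : 0 < (2 : ℝ) ^ (1 / ν) := by positivity
  set T := (Ioc 0 ⌊x⌋₊).filter (fun n : ℕ => n.Coprime (primesProdBelow z) ∧ ¬ Squarefree n)
    with hT
  have hT_mass : ∑ n ∈ T, A.a n ≤ Real.sqrt (2 * x / z * (Kc * x * Real.log x ^ Cc)) := by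
    have hTsub : T ⊆ Ioc 0 ⌊x⌋₊ := Finset.filter_subset _ _
    refine (sum_le_sqrt_card_mul_sum_sq A.a A.a_nonneg hTsub).trans (Real.sqrt_le_sqrt ?_)
    have hcardT := card_rough_not_squarefree_le (x := x) hz hx0.le
    rw [← hT] at hcardT
    exact mul_le_mul hcardT hcr (Finset.sum_nonneg fun n _ => sq_nonneg _) (by positivity)
  -- the target inequality, squared
  have hxν : 0 < x ^ ν := Real.rpow_pos_of_pos hx0 ν
  have hA' : Real.log x ^ (Cc + 2) * ((2 : ℝ) ^ (2 / ν + 3) * Kc) ≤ x ^ ν := by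
    have h1 : Real.log x ^ (Cc + 2) ≤ ((2 : ℝ) ^ (2 / ν + 3) * Kc)⁻¹ * x ^ ν :=
      (div_le_iff₀ hxν).mp hsmall
    have h2 : 0 < (2 : ℝ) ^ (2 / ν + 3) * Kc := by positivity
    calc Real.log x ^ (Cc + 2) * ((2 : ℝ) ^ (2 / ν + 3) * Kc)
        ≤ ((2 : ℝ) ^ (2 / ν + 3) * Kc)⁻¹ * x ^ ν * ((2 : ℝ) ^ (2 / ν + 3) * Kc) :=
          mul_le_mul_of_nonneg_right h1 h2.le
      _ = x ^ ν := by field_simp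
  have hsplitlog : Real.log x ^ (Cc + 2) = Real.log x ^ Cc * Real.log x ^ 2 := by
    rw [Real.rpow_add hlogx0, Real.rpow_two]
  have hsplit2 : (2 : ℝ) ^ (2 / ν + 3) = ((2 : ℝ) ^ (1 / ν)) ^ 2 * 8 := by
    have h8 : (2 : ℝ) ^ (3 : ℝ) = 8 := by norm_num
    rw [Real.rpow_add two_pos, h8, ← Real.rpow_natCast ((2 : ℝ) ^ (1 / ν)) 2,
      ← Real.rpow_mul zero_le_two]
    congr 2
    push_cast
    ring
  rw [hsplitlog, hsplit2] at hA'
  have hmain : 2 * x * (Kc * x * Real.log x ^ Cc) * (2 * Real.log x * (2 : ℝ) ^ (1 / ν)) ^ 2 ≤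
      x ^ 2 * x ^ ν := by
    have : 2 * x * (Kc * x * Real.log x ^ Cc) * (2 * Real.log x * (2 : ℝ) ^ (1 / ν)) ^ 2 =
        x ^ 2 * (Real.log x ^ Cc * Real.log x ^ 2 * (((2 : ℝ) ^ (1 / ν)) ^ 2 * 8 * Kc)) := by
      ring
    rw [this]
    exact mul_le_mul_of_nonneg_left hA' (by positivity)
  have htarget : 2 * x / z * (Kc * x * Real.log x ^ Cc) ≤
      (x / (2 * Real.log x * (2 : ℝ) ^ (1 / ν))) ^ 2 := by
    rw [div_pow, le_div_iff₀ (by positivity)]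
    calc 2 * x / z * (Kc * x * Real.log x ^ Cc) * (2 * Real.log x * (2 : ℝ) ^ (1 / ν)) ^ 2
        = (2 * x * (Kc * x * Real.log x ^ Cc) * (2 * Real.log x * (2 : ℝ) ^ (1 / ν)) ^ 2) / z := by
          ring
      _ ≤ (x ^ 2 * x ^ ν) / z := div_le_div_of_nonneg_right hmain hz0.le
      _ ≤ (x ^ 2 * z) / z := by gcongr
      _ = x ^ 2 := by field_simp
  have hsq : Real.sqrt (2 * x / z * (Kc * x * Real.log x ^ Cc)) ≤
      x / (2 * Real.log x * (2 : ℝ) ^ (1 / ν)) := by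
    rw [← Real.sqrt_sq (show 0 ≤ x / (2 * Real.log x * (2 : ℝ) ^ (1 / ν)) by positivity)]
    exact Real.sqrt_le_sqrt htarget
  calc (2 : ℝ) ^ (1 / ν) * ∑ n ∈ T, A.a n
      ≤ (2 : ℝ) ^ (1 / ν) * (x / (2 * Real.log x * (2 : ℝ) ^ (1 / ν))) :=
        mul_le_mul_of_nonneg_left (hT_mass.trans hsq) h2ν.le
    _ = x / (2 * Real.log x) := by field_simp

/-! ### [FriedlanderIwaniecPisa1978] Lemma 11 under the tree hypotheses -/

/-- The squarefree part of the proof of Lemma 11: the fundamental lemma (upper half) for the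
subsequences `𝒜_m`, `m ≤ x/y` rough and squarefree, at level `z²`, size `g(m) x`, with all
moduli `m d` squarefree and `< x^{1−ε}`. [cite: FriedlanderIwaniecPisa1978, Lemma 11 (proof)] -/
theorem sum_sifted_restrictDvd_squarefree_le (A : SieveSequence) {K : ℝ}
    (hK : HasSieveDimension A.density 1 K) (hsize : ∀ x, A.size x = x) {x y z ε : ℝ}
    (hx : 1 < x) (hz : 2 ≤ z) (hzxy : z ≤ x / y) (hy : 0 < y) (hlev : x / y * z ^ 2 < x ^ (1 - ε)) :
    ∑ m ∈ ((Ioc 0 ⌊x / y⌋₊).filter (fun m : ℕ => m.Coprime (primesProdBelow z))).filter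
        Squarefree, (A.restrictDvd m).sifted x (primesProdBelow z) ≤
      (1 + SieveSequence.flConst 1 K) * x * A.densityProduct (primesProdBelow z) *
          (2 * K * Real.log (x / y) / Real.log z) +
        ∑ q ∈ (Ico 1 ⌈x ^ (1 - ε)⌉₊).filter Squarefree, |A.remainder q x| := by
  have hx0 : 0 < x := by linarith
  have hz0 : 0 < z := by linarith
  have hlogz : 0 < Real.log z := Real.log_pos (by linarith)
  have hxy0 : 0 ≤ x / y := div_nonneg hx0.le hy.le
  have hK1 : 1 ≤ K := hK.one_le
  have hg0 : ∀ p : ℕ, p.Prime → 0 ≤ A.density p := fun p hp => (hK.1 p hp).1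
  set CF := SieveSequence.flConst 1 K with hCF
  have hCF0 : 0 < CF := SieveSequence.flConst_pos zero_le_one (by linarith)
  set P := primesProdBelow z with hP
  set V := A.densityProduct P with hVdef
  have hV0 : 0 ≤ V := by
    rw [hVdef, hP, densityProduct_primesProdBelow]
    exact Finset.prod_nonneg fun p hp =>
      (sub_pos.mpr (hK.1 p (Nat.prime_of_mem_primesBelow hp)).2).le
  set M := (Ioc 0 ⌊x / y⌋₊).filter (fun m : ℕ => m.Coprime P) with hM
  -- the fundamental lemma for each squarefree `m`
  have hFLm : ∀ m ∈ M.filter Squarefree,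
      (A.restrictDvd m).sifted x P ≤ (1 + CF) * x * V * (|(μ m : ℝ)| * A.density m) +
        ∑ d ∈ P.divisors.filter (fun d : ℕ => (d : ℝ) ≤ z ^ 2), |A.remainder (m * d) x| := by
    intro m hm
    obtain ⟨hm, hmsf⟩ := Finset.mem_filter.mp hm
    obtain ⟨hm', hmP⟩ := Finset.mem_filter.mp hm
    have hgm : 0 ≤ A.density m := by
      rw [BetaSieve.map_eq_prod_primeFactors A.density_mult hmsf]
      exact Finset.prod_nonneg fun p hp => hg0 p (Nat.prime_of_mem_primeFactors hp)
    have hμm : |(μ m : ℝ)| = 1 := by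
      rw [ArithmeticFunction.moebius_apply_of_squarefree hmsf]; push_cast
      rw [abs_pow, abs_neg, abs_one, one_pow]
    have hsz' : (A.restrictDvd m).size x = A.density m * x := by
      show A.density m * A.size x = _; rw [hsize]
    have hsz : 0 ≤ (A.restrictDvd m).size x := by rw [hsz']; exact mul_nonneg hgm hx0.le
    have hzz : z ≤ z ^ 2 := by nlinarith
    have h := SieveSequence.fundamental_lemma_explicit (A := A.restrictDvd m) (κ := 1) (K := K)
      hK one_pos (x := x) hz hzz hsz
    have hden' : (A.restrictDvd m).densityProduct (primesProdBelow z) = V := rfl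
    rw [hsz', hden', ← hP, ← hCF] at h
    have hrem : ∑ d ∈ P.divisors.filter (fun d : ℕ => (d : ℝ) ≤ z ^ 2),
        |(A.restrictDvd m).remainder d x| =
        ∑ d ∈ P.divisors.filter (fun d : ℕ => (d : ℝ) ≤ z ^ 2), |A.remainder (m * d) x| := by
      refine Finset.sum_congr rfl fun d hd => ?_
      have hdP : d ∣ P := Nat.dvd_of_mem_divisors (Finset.mem_filter.mp hd).1
      rw [remainder_restrictDvd A (hmP.coprime_dvd_right hdP)]
    rw [hrem] at h
    have hexp : Real.exp (-(Real.log (z ^ 2) / Real.log z)) ≤ 1 := by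
      rw [Real.exp_le_one_iff, neg_nonpos]
      exact div_nonneg (Real.log_nonneg (by nlinarith)) hlogz.le
    have hup := (abs_sub_le_iff.mp h).1
    have hgxV : 0 ≤ CF * (A.density m * x) * V := by positivity
    have hmain : A.density m * x * V +
        CF * (A.density m * x) * V * Real.exp (-(Real.log (z ^ 2) / Real.log z)) ≤
        (1 + CF) * x * V * (|(μ m : ℝ)| * A.density m) := by
      rw [hμm, one_mul]
      calc A.density m * x * V +
            CF * (A.density m * x) * V * Real.exp (-(Real.log (z ^ 2) / Real.log z))
          ≤ A.density m * x * V + CF * (A.density m * x) * V * 1 := by gcongr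
        _ = (1 + CF) * x * V * A.density m := by ring
    linarith
  -- Lemma 8 for the main terms
  have h8' : ∑ m ∈ M.filter Squarefree, |(μ m : ℝ)| * A.density m ≤
      2 * K * Real.log (x / y) / Real.log z := by
    refine le_trans (Finset.sum_le_sum_of_subset_of_nonneg (Finset.filter_subset _ _)
      fun m _ _ => ?_) (sum_rough_abs_moebius_mul_density_le A hK hz hzxy)
    by_cases hmsf : Squarefree m
    · refine mul_nonneg (abs_nonneg _) ?_
      rw [BetaSieve.map_eq_prod_primeFactors A.density_mult hmsf]
      exact Finset.prod_nonneg fun p hp => hg0 p (Nat.prime_of_mem_primeFactors hp)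
    · rw [ArithmeticFunction.moebius_eq_zero_of_not_squarefree hmsf]; simp
  -- rearranging the remainders
  have hRsum : ∑ m ∈ M.filter Squarefree,
      ∑ d ∈ P.divisors.filter (fun d : ℕ => (d : ℝ) ≤ z ^ 2), |A.remainder (m * d) x| ≤
      ∑ q ∈ (Ico 1 ⌈x ^ (1 - ε)⌉₊).filter Squarefree, |A.remainder q x| := by
    set f : ℕ → ℝ := fun q => if Squarefree q then |A.remainder q x| else 0 with hf
    have hf0 : ∀ q, 0 ≤ f q := fun q => by rw [hf]; simp only; split_ifs <;> simp
    have hMs : ∀ m ∈ M.filter Squarefree, m ≠ 0 ∧ m.Coprime P := fun m hm =>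
      ⟨(Finset.mem_Ioc.mp (Finset.mem_filter.mp (Finset.mem_filter.mp hm).1).1).1.ne',
        (Finset.mem_filter.mp (Finset.mem_filter.mp hm).1).2⟩
    have hL : ∀ m ∈ M.filter Squarefree, (m : ℝ) * z ^ 2 < x ^ (1 - ε) := by
      intro m hm
      have hmX : (m : ℝ) ≤ x / y :=
        (Nat.cast_le.mpr (Finset.mem_Ioc.mp (Finset.mem_filter.mp
          (Finset.mem_filter.mp hm).1).1).2).trans (Nat.floor_le hxy0)
      exact (mul_le_mul_of_nonneg_right hmX (sq_nonneg z)).trans_lt hlev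
    have heq : ∑ m ∈ M.filter Squarefree,
        ∑ d ∈ P.divisors.filter (fun d : ℕ => (d : ℝ) ≤ z ^ 2), |A.remainder (m * d) x| =
        ∑ m ∈ M.filter Squarefree,
          ∑ d ∈ P.divisors.filter (fun d : ℕ => (d : ℝ) ≤ z ^ 2), f (m * d) := by
      refine Finset.sum_congr rfl fun m hm => Finset.sum_congr rfl fun d hd => ?_
      obtain ⟨hm, hmsf⟩ := Finset.mem_filter.mp hm
      have hmP : m.Coprime P := (Finset.mem_filter.mp hm).2
      have hdP : d ∣ P := Nat.dvd_of_mem_divisors (Finset.mem_filter.mp hd).1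
      have hdsf : Squarefree d := (squarefree_primesProdBelow z).squarefree_of_dvd (hP ▸ hdP)
      have hmd : Squarefree (m * d) :=
        Nat.squarefree_mul_iff.mpr ⟨hmP.coprime_dvd_right hdP, hmsf, hdsf⟩
      rw [hf]; simp only; rw [if_pos hmd]
    rw [heq]
    refine (sum_coprime_sum_divisors_le (hP ▸ primesProdBelow_ne_zero z) f hf0 _ hMs
      (z ^ 2) (x ^ (1 - ε)) hL).trans (le_of_eq ?_)
    rw [hf, Finset.sum_ite, Finset.sum_const_zero, add_zero]
  refine (Finset.sum_le_sum hFLm).trans ?_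
  rw [Finset.sum_add_distrib, ← Finset.mul_sum]
  exact add_le_add (mul_le_mul_of_nonneg_left h8' (by positivity)) hRsum

/-- **[FriedlanderIwaniecPisa1978] Lemma 11 under the hypotheses of `Literature.NumberTheory.Sieve.bombieri_asymptotic_sieve`**
(size `X(x) = x`, `HasSieveDimension`, `HasDensityConstant`, level `x^θ` for every `θ < 1` on
squarefree moduli, `∑ a_n² ≪ x (log x)^C`): there is `C` such that for all `ε, ν > 0`, all large
`x`, and `x^ν ≤ z`, `z ≥ 2`, `zy < x`, `z √x < y < x^{1−ε}`,
`|Σ₂| ≤ C x (log x/y)^{k+1} (log z)^{−2}`. Proof as printed (p. 738): `|μ(d)|(log n/d)^k ≤ (log x/y)^k`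
for `d ≥ y` (`abs_sigma2_le`), then the upper bound of the fundamental lemma
(`SieveSequence.fundamental_lemma_explicit`) for the subsequences `𝒜_m`, `m ≤ x/y` rough and
SQUAREFREE (moduli `νm ≤ z² x/y < x^{1−ε}`, all squarefree; `sum_sifted_restrictDvd_squarefree_le`),
`V(z) ≪ 1/log z` (`exists_densityProduct_le`) and `∑_{m} |μ(m)| g(m) ≪ log(x/y)/log z`
(`sum_rough_abs_moebius_mul_density_le`); the non-squarefree rough `m` contribute at most
`2^{1/ν} ∑_{n ≤ x rough, n not squarefree} a_n ≤ 2^{1/ν} (2x/z · ∑ a_n²)^{1/2} ≤ x/(2 log x)` by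
Cauchy–Schwarz (`mass_rough_not_squarefree_le`). [cite: FriedlanderIwaniecPisa1978, Lemma 11] -/
theorem treeLemma11 (k : ℕ) (A : SieveSequence) (H : ℝ) (hsize : ∀ x, A.size x = x)
    (hdim : ∃ K : ℝ, HasSieveDimension A.density 1 K) (hH : A.HasDensityConstant H)
    (hlevel : ∀ θ : ℝ, θ < 1 → HasLevelOfDistribution A θ)
    (hcrude : ∃ C : ℝ, (fun x : ℝ => ∑ n ∈ Ioc 0 ⌊x⌋₊, A.a n ^ 2) =O[atTop]
      fun x : ℝ => x * Real.log x ^ C) :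
    ∃ C : ℝ, ∀ ε : ℝ, 0 < ε → ∀ ν : ℝ, 0 < ν → ∀ᶠ x : ℝ in atTop, ∀ y z : ℝ,
      2 ≤ z → x ^ ν ≤ z → z * y < x → z * Real.sqrt x < y → y < x ^ (1 - ε) →
        |sigma2 A k x y z| ≤ C * x * Real.log (x / y) ^ (k + 1) / Real.log z ^ 2 := by
  obtain ⟨K, hK⟩ := hdim
  have hK1 : 1 ≤ K := hK.one_le
  set CF := SieveSequence.flConst 1 K with hCF
  have hCF0 : 0 < CF := SieveSequence.flConst_pos zero_le_one (by linarith)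
  obtain ⟨CV, hCV0, hV⟩ := exists_densityProduct_le A hH
  obtain ⟨Cc, hCc0, Kc, hKc0, hcr⟩ := crude_bound A hcrude
  refine ⟨2 * K * (1 + CF) * CV + 1, fun ε hε ν hν => ?_⟩
  obtain ⟨CR, hCR0, hR⟩ := level_bound A hsize hlevel (half_pos hε) ((k : ℝ) + 3)
  have hev1 : ∀ᶠ x : ℝ in atTop, 2 * CR ≤ Real.log x ^ (k + 2) :=
    ((tendsto_pow_atTop (by omega : k + 2 ≠ 0)).comp Real.tendsto_log_atTop).eventually_ge_atTop _
  have hev2 : ∀ᶠ x : ℝ in atTop,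
      Real.log x ^ (Cc + 2) / x ^ ν ≤ ((2 : ℝ) ^ (2 / ν + 3) * Kc)⁻¹ := by
    have hlo := (isLittleO_log_rpow_rpow_atTop (Cc + 2) hν).tendsto_div_nhds_zero
    exact ((tendsto_order.1 hlo).2 _ (by positivity)).mono fun x hx => hx.le
  filter_upwards [hR, hev1, hev2, eventually_ge_atTop (3 : ℝ)] with x hRx hx1' hx2' hx3
    y z hz hxz hzy hzx hyx
  -- the parameters
  have hx0 : 0 < x := by linarith
  have hx1 : 1 < x := by linarith
  have hlogx1 : 1 ≤ Real.log x := by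
    rw [← Real.log_exp 1]
    exact Real.log_le_log (Real.exp_pos 1) (le_trans (by
      have := Real.exp_one_lt_d9; norm_num at this ⊢; linarith) hx3)
  have hlogx0 : 0 < Real.log x := by linarith
  have hz0 : 0 < z := by linarith
  have hz1 : 1 < z := by linarith
  have hsqrt1 : 1 ≤ Real.sqrt x := by rw [← Real.sqrt_one]; exact Real.sqrt_le_sqrt hx1.le
  have hsqrt0 : 0 < Real.sqrt x := by linarith
  have hy2 : 2 ≤ y := by nlinarith
  have hy0 : 0 < y := by linarith
  have hy1 : 1 ≤ y := by linarith
  have hxε : x ^ (1 - ε) ≤ x := by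
    calc x ^ (1 - ε) ≤ x ^ (1 : ℝ) := Real.rpow_le_rpow_of_exponent_le hx1.le (by linarith)
      _ = x := Real.rpow_one x
  have hyx' : y ≤ x := hyx.le.trans hxε
  have hzxy : z < x / y := by rwa [lt_div_iff₀ hy0]
  have hzx' : z ≤ x := hzxy.le.trans (div_le_self hx0.le hy1)
  have hlogz : 0 < Real.log z := Real.log_pos hz1
  have hlogxy : Real.log z ≤ Real.log (x / y) := Real.log_le_log hz0 hzxy.le
  have hlogxy0 : 0 < Real.log (x / y) := hlogz.trans_le hlogxy
  have hlogzx : Real.log z ≤ Real.log x := Real.log_le_log hz0 hzx'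
  -- the level: `z² · x/y < z √x < y < x^{1−ε}`
  have hlev : x / y * z ^ 2 < x ^ (1 - ε) := by
    have h1 : x / y * z ^ 2 < z * Real.sqrt x := by
      rw [div_mul_eq_mul_div, div_lt_iff₀ hy0]
      have hsx : Real.sqrt x ^ 2 = x := Real.sq_sqrt hx0.le
      have h2 : Real.sqrt x * z < y := by linarith
      calc x * z ^ 2 = (Real.sqrt x * z) * (z * Real.sqrt x) := by
            linear_combination (-(z ^ 2)) * hsx
        _ < y * (z * Real.sqrt x) := mul_lt_mul_of_pos_right h2 (mul_pos hz0 hsqrt0)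
        _ = z * Real.sqrt x * y := by ring
    exact h1.trans (hzx.trans hyx)
  set P := primesProdBelow z with hP
  set V := A.densityProduct P with hVdef
  have hVle : V ≤ CV / Real.log z := hV z hz
  set M := (Ioc 0 ⌊x / y⌋₊).filter (fun m : ℕ => m.Coprime P) with hM
  -- Step 1: `|Σ₂| ≤ (log x/y)^k ∑_m S(𝒜_m, z; x)`
  have h1 := abs_sigma2_le A k z hy0 hyx'
  rw [← hP] at h1
  -- Step 2: the squarefree `m`
  have hsf := sum_sifted_restrictDvd_squarefree_le A hK hsize (ε := ε) hx1 hz hzxy.le hy0 hlev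
  rw [← hP, ← hCF] at hsf
  have hRle : ∑ q ∈ (Ico 1 ⌈x ^ (1 - ε)⌉₊).filter Squarefree, |A.remainder q x| ≤
      CR * x / Real.log x ^ ((k : ℝ) + 3) := by
    refine le_trans (Finset.sum_le_sum_of_subset_of_nonneg ?_ fun q _ _ => abs_nonneg _) hRx
    intro q hq
    rw [Finset.mem_filter, Finset.mem_Ico] at hq
    rw [Finset.mem_filter, Finset.mem_Icc]
    refine ⟨⟨hq.1.1, Nat.le_floor ?_⟩, hq.2⟩
    have hq1 : (q : ℝ) < x ^ (1 - ε) := by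
      have h2 : ((q + 1 : ℕ) : ℝ) ≤ ⌈x ^ (1 - ε)⌉₊ := by exact_mod_cast hq.1.2
      have h3 : (⌈x ^ (1 - ε)⌉₊ : ℝ) < x ^ (1 - ε) + 1 :=
        Nat.ceil_lt_add_one (Real.rpow_nonneg hx0.le _)
      push_cast at h2; linarith
    exact hq1.le.trans (Real.rpow_le_rpow_of_exponent_le hx1.le (by linarith))
  -- Step 3: the non-squarefree `m`
  have hnsf := (sum_sifted_restrictDvd_not_squarefree_le A (y := y) hν hx1 hz hxz).trans
    (mass_rough_not_squarefree_le A hν hx1 hz hxz hKc0 (hcr x (by linarith)) hx2')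
  rw [← hP] at hnsf
  -- Step 4: assembling
  have hsumS : ∑ m ∈ M, (A.restrictDvd m).sifted x P ≤
      (1 + CF) * x * V * (2 * K * Real.log (x / y) / Real.log z) +
        CR * x / Real.log x ^ ((k : ℝ) + 3) + x / (2 * Real.log x) := by
    rw [← Finset.sum_filter_add_sum_filter_not M Squarefree]
    exact add_le_add (hsf.trans (add_le_add le_rfl hRle)) hnsf
  have hT1 : (1 + CF) * x * V * (2 * K * Real.log (x / y) / Real.log z) ≤
      2 * K * (1 + CF) * CV * x * Real.log (x / y) / Real.log z ^ 2 := by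
    have hnn : 0 ≤ (1 + CF) * x * (2 * K * Real.log (x / y) / Real.log z) := by positivity
    calc (1 + CF) * x * V * (2 * K * Real.log (x / y) / Real.log z)
        = (1 + CF) * x * (2 * K * Real.log (x / y) / Real.log z) * V := by ring
      _ ≤ (1 + CF) * x * (2 * K * Real.log (x / y) / Real.log z) * (CV / Real.log z) :=
          mul_le_mul_of_nonneg_left hVle hnn
      _ = 2 * K * (1 + CF) * CV * x * Real.log (x / y) / Real.log z ^ 2 := by
          field_simp
  have hT2 : CR * x / Real.log x ^ ((k : ℝ) + 3) + x / (2 * Real.log x) ≤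
      x * Real.log (x / y) / Real.log z ^ 2 := by
    have ha : CR / Real.log x ^ ((k : ℝ) + 3) ≤ 1 / (2 * Real.log x) := by
      have hpow : Real.log x ^ ((k : ℝ) + 3) = Real.log x ^ (k + 2) * Real.log x := by
        rw [show ((k : ℝ) + 3) = ((k + 3 : ℕ) : ℝ) by push_cast; ring, Real.rpow_natCast,
          pow_succ]
      rw [hpow, div_le_div_iff₀ (by positivity) (by positivity)]
      nlinarith
    have hb : 1 / (2 * Real.log x) + 1 / (2 * Real.log x) = 1 / Real.log x := by
      field_simp; ring
    have hc : 1 / Real.log x ≤ Real.log (x / y) / Real.log z ^ 2 := by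
      calc 1 / Real.log x ≤ 1 / Real.log z := one_div_le_one_div_of_le hlogz hlogzx
        _ ≤ Real.log (x / y) / Real.log z ^ 2 := by
            rw [div_le_div_iff₀ hlogz (pow_pos hlogz 2), one_mul, pow_two]
            exact mul_le_mul_of_nonneg_right hlogxy hlogz.le
    calc CR * x / Real.log x ^ ((k : ℝ) + 3) + x / (2 * Real.log x)
        = x * (CR / Real.log x ^ ((k : ℝ) + 3) + 1 / (2 * Real.log x)) := by ring
      _ ≤ x * (1 / (2 * Real.log x) + 1 / (2 * Real.log x)) := by gcongr
      _ = x * (1 / Real.log x) := by rw [hb]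
      _ ≤ x * (Real.log (x / y) / Real.log z ^ 2) := mul_le_mul_of_nonneg_left hc hx0.le
      _ = x * Real.log (x / y) / Real.log z ^ 2 := by ring
  calc |sigma2 A k x y z|
      ≤ Real.log (x / y) ^ k * ∑ m ∈ M, (A.restrictDvd m).sifted x P := h1
    _ ≤ Real.log (x / y) ^ k * (2 * K * (1 + CF) * CV * x * Real.log (x / y) / Real.log z ^ 2 +
          x * Real.log (x / y) / Real.log z ^ 2) := by
        refine mul_le_mul_of_nonneg_left (hsumS.trans ?_) (pow_nonneg hlogxy0.le k)
        linarith
    _ = (2 * K * (1 + CF) * CV + 1) * x * Real.log (x / y) ^ (k + 1) / Real.log z ^ 2 := by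
        ring

end BombieriSieve

end Literature.NumberTheory.Sieve
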